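import Mathlib.Analysis.SpecialFunctions.Complex.Arg
import Mathlib.Analysis.SpecialFunctions.Trigonometric.Bounds
import Mathlib.Data.Matrix.Mul
import Literature.Barriers.PneNP.TSPExtensionComplexityHyperplaneBound
import HarnessLib

/-!
# Route `SmallBlockRothvoss` (cell pnp-psdrank, T-SOC): angular cells for the `ε`-net sandwich

Polar form of vectors of `ℝ²` (`⟪u,v⟫² = |u|²|v|² cos²(arg u − arg v)`), the `J` angular cells of `(-π, π]`,
the pointwise sandwich/garbage inequalities and the choice of `J` (`net_constants`).
Landing kit prepared by pnp-psdrank-eng g3 from the farm-checked cumulative work file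
`HOME/pnp-psdrank-eng/lean/SocLift.lean` (rc 0, 0 sorries, axioms standard). See landing/README.md.
-/

set_option linter.dupNamespace false -- `Summit.PneNP.PneNP.…`: summit = sub-problem (D-0017)

noncomputable section

open Finset Real

namespace Summit.PneNP.PneNP.Theorems.SmallBlockRothvoss

/-! ### Polar form of vectors of `ℝ²` -/

/-- The complex number `u 0 + u 1 · i` attached to `u : Fin 2 → ℝ`. -/
def toC (u : Fin 2 → ℝ) : ℂ := ⟨u 0, u 1⟩

/-- The polar angle of `u : Fin 2 → ℝ`, in `(-π, π]`. -/
def ang (u : Fin 2 → ℝ) : ℝ := Complex.arg (toC u)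

/-- The polar angle lies in `(-π, π]`. -/
theorem ang_mem (u : Fin 2 → ℝ) : ang u ∈ Set.Ioc (-π) π := Complex.arg_mem_Ioc _

/-- First coordinate in polar form. -/
theorem coord_zero_eq (u : Fin 2 → ℝ) : u 0 = ‖toC u‖ * Real.cos (ang u) := by
  rw [ang, Complex.norm_mul_cos_arg]; rfl

/-- Second coordinate in polar form. -/
theorem coord_one_eq (u : Fin 2 → ℝ) : u 1 = ‖toC u‖ * Real.sin (ang u) := by
  rw [ang, Complex.norm_mul_sin_arg]; rfl

/-- The dot product on `Fin 2 → ℝ`, expanded. -/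
theorem dotProduct_fin_two (u v : Fin 2 → ℝ) : dotProduct u v = u 0 * v 0 + u 1 * v 1 := by
  simp [dotProduct, Fin.sum_univ_two]

/-- `|u|² = ⟪u, u⟫`. -/
theorem norm_toC_sq (u : Fin 2 → ℝ) : ‖toC u‖ ^ 2 = dotProduct u u := by
  rw [Complex.sq_norm, Complex.normSq_apply, dotProduct_fin_two]; rfl

/-- `⟪u, v⟫ = |u| |v| cos(φ_u − φ_v)`. -/
theorem dotProduct_eq_polar (u v : Fin 2 → ℝ) :
    dotProduct u v = ‖toC u‖ * ‖toC v‖ * Real.cos (ang u - ang v) := by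
  rw [dotProduct_fin_two, coord_zero_eq u, coord_one_eq u, coord_zero_eq v, coord_one_eq v,
    Real.cos_sub]
  ring

/-- `⟪u, v⟫² = |u|² |v|² cos²(φ_u − φ_v)`. -/
theorem dotProduct_sq_eq_polar (u v : Fin 2 → ℝ) :
    (dotProduct u v) ^ 2 = dotProduct u u * dotProduct v v * Real.cos (ang u - ang v) ^ 2 := by
  rw [dotProduct_eq_polar, ← norm_toC_sq, ← norm_toC_sq]
  ring


/-! ### Angular cells: `J` arcs of width `2π/J` covering `(-π, π]` -/

/-- Width of the angular cells. -/
def width (J : ℕ) : ℝ := 2 * π / J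

/-- Centre of the `i`-th cell `(-π + i·w, -π + (i+1)·w]`. -/
def center (J : ℕ) (i : ℕ) : ℝ := -π + ((i : ℝ) + 1 / 2) * width J

/-- Index of the cell containing the angle `φ ∈ (-π, π]`. -/
def idx (J : ℕ) (φ : ℝ) : ℕ := ⌈(φ + π) / width J⌉₊ - 1

/-- Cells have positive width. -/
theorem width_pos {J : ℕ} (hJ : 0 < J) : 0 < width J := by
  unfold width
  have : (0 : ℝ) < J := by exact_mod_cast hJ
  positivity

/-- The cell index of an angle in `(-π, π]` is `< J`. -/
theorem idx_lt {J : ℕ} (hJ : 0 < J) {φ : ℝ} (hφ : φ ∈ Set.Ioc (-π) π) : idx J φ < J := by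
  have hw := width_pos hJ
  have hx0 : 0 < (φ + π) / width J := div_pos (by linarith [hφ.1]) hw
  have hxJ : (φ + π) / width J ≤ (J : ℝ) := by
    rw [div_le_iff₀ hw, width]
    have hJ' : (0 : ℝ) < J := by exact_mod_cast hJ
    rw [mul_div_assoc', le_div_iff₀ hJ']
    nlinarith [hφ.2]
  have hc1 : 1 ≤ ⌈(φ + π) / width J⌉₊ := Nat.one_le_iff_ne_zero.2 (Nat.pos_iff_ne_zero.1 (Nat.ceil_pos.2 hx0))
  have hcJ : ⌈(φ + π) / width J⌉₊ ≤ J := Nat.ceil_le.2 hxJ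
  unfold idx
  omega

/-- An angle is within half a width of the centre of its cell. -/
theorem abs_sub_center_le {J : ℕ} (hJ : 0 < J) {φ : ℝ} (hφ : φ ∈ Set.Ioc (-π) π) :
    |φ - center J (idx J φ)| ≤ width J / 2 := by
  have hw := width_pos hJ
  set x : ℝ := (φ + π) / width J with hx
  have hx0 : 0 < x := div_pos (by linarith [hφ.1]) hw
  have hc1 : 1 ≤ ⌈x⌉₊ := Nat.one_le_iff_ne_zero.2 (Nat.pos_iff_ne_zero.1 (Nat.ceil_pos.2 hx0))
  have hup : x ≤ (⌈x⌉₊ : ℝ) := Nat.le_ceil x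
  have hlow : (⌈x⌉₊ : ℝ) < x + 1 := Nat.ceil_lt_add_one hx0.le
  have hi : ((idx J φ : ℕ) : ℝ) = (⌈x⌉₊ : ℝ) - 1 := by
    unfold idx
    rw [← hx, Nat.cast_sub hc1, Nat.cast_one]
  have hφx : φ = -π + x * width J := by
    rw [hx, div_mul_cancel₀ _ hw.ne']; ring
  rw [center, hi, hφx]
  have : -π + x * width J - (-π + ((⌈x⌉₊ : ℝ) - 1 + 1 / 2) * width J) =
      (x - (⌈x⌉₊ : ℝ) + 1 / 2) * width J := by ring
  rw [this, abs_mul, abs_of_pos hw]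
  have h1 : |x - (⌈x⌉₊ : ℝ) + 1 / 2| ≤ 1 / 2 := abs_le.2 ⟨by linarith, by linarith⟩
  calc |x - (⌈x⌉₊ : ℝ) + 1 / 2| * width J ≤ 1 / 2 * width J :=
        mul_le_mul_of_nonneg_right h1 hw.le
    _ = width J / 2 := by ring

/-- Centres differ by integer multiples of the width. -/
theorem center_sub_center (J i j : ℕ) : center J i - center J j = ((i : ℝ) - j) * width J := by
  unfold center; ring

/-- Within a pair of cells, `|cos(φ − ψ)|` is within `w` of its value at the cell centres. -/
theorem abs_abs_cos_sub_le {J : ℕ} {φ ψ : ℝ} {i j : ℕ} (hφ : |φ - center J i| ≤ width J / 2)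
    (hψ : |ψ - center J j| ≤ width J / 2) :
    |(|Real.cos (φ - ψ)|) - (|Real.cos (((i : ℝ) - j) * width J)|)| ≤ width J := by
  calc |(|Real.cos (φ - ψ)|) - (|Real.cos (((i : ℝ) - j) * width J)|)|
      ≤ |Real.cos (φ - ψ) - Real.cos (((i : ℝ) - j) * width J)| := abs_abs_sub_abs_le_abs_sub _ _
    _ ≤ |(φ - ψ) - ((i : ℝ) - j) * width J| := Real.abs_cos_sub_cos_le _ _
    _ = |(φ - center J i) - (ψ - center J j)| := by rw [← center_sub_center]; ring_nf
    _ ≤ |φ - center J i| + |ψ - center J j| := abs_sub _ _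
    _ ≤ width J / 2 + width J / 2 := add_le_add hφ hψ
    _ = width J := by ring


/-! ### Pointwise steps -/

/-- Pointwise sandwich: if `clo·P ≤ G ≤ chi·P` with `chi ≤ (1+η)·clo` and `kA, kB, P, η ≥ 0`,
then `(kA − kB)·G ≤ clo·(kA − kB)·P + η·kA·G`. -/
theorem pointwise_sandwich {kA kB G P clo chi η : ℝ} (hkA : 0 ≤ kA) (hkB : 0 ≤ kB) (hP : 0 ≤ P)
    (hη : 0 ≤ η) (hchi : chi ≤ (1 + η) * clo) (hlo : clo * P ≤ G)
    (hhi : G ≤ chi * P) :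
    (kA - kB) * G ≤ clo * ((kA - kB) * P) + η * (kA * G) := by
  have h1 : kA * G ≤ kA * ((1 + η) * clo * P) := by
    apply mul_le_mul_of_nonneg_left _ hkA
    calc G ≤ chi * P := hhi
      _ ≤ (1 + η) * clo * P := mul_le_mul_of_nonneg_right hchi hP
  have h2 : kB * (clo * P) ≤ kB * G := mul_le_mul_of_nonneg_left hlo hkB
  have h3 : η * (kA * (clo * P)) ≤ η * (kA * G) :=
    mul_le_mul_of_nonneg_left (mul_le_mul_of_nonneg_left hlo hkA) hη
  nlinarith [h1, h2, h3]

/-- The constants of a good cell pair: if `(6/η + 1)·w ≤ κ`, `0 < η ≤ 1`, `0 ≤ w`, then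
`(κ + w)² ≤ (1 + η)(κ − w)²`. -/
theorem good_ratio {κ w η : ℝ} (hη : 0 < η) (hη1 : η ≤ 1) (hw : 0 ≤ w)
    (hgood : (6 / η + 1) * w ≤ κ) : (κ + w) ^ 2 ≤ (1 + η) * (κ - w) ^ 2 := by
  set u := κ - w with hu
  have hu6 : 6 * w ≤ η * u := by
    have : (6 / η + 1) * w = 6 / η * w + w := by ring
    rw [this] at hgood
    have h' : 6 / η * w ≤ u := by linarith
    have := mul_le_mul_of_nonneg_left h' hη.le
    rwa [← mul_assoc, mul_div_cancel₀ _ hη.ne'] at this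
  have hu2 : 2 * w ≤ u := by nlinarith
  have hu0 : 0 ≤ u := by linarith
  have hk : κ + w = u + 2 * w := by rw [hu]; ring
  rw [hk]
  nlinarith [mul_nonneg hu0 hw, mul_nonneg hη.le (mul_nonneg hu0 hu0)]

/-- Sum of an indicator-restricted function over `univ`. -/
theorem sum_ite_mem_univ {ι : Type*} [Fintype ι] [DecidableEq ι] (X : Finset ι) (f : ι → ℝ) :
    ∑ i, (if i ∈ X then f i else 0) = ∑ i ∈ X, f i := by
  rw [Finset.sum_ite_mem, Finset.univ_inter]

/-- `G = ⟪a, b⟫² ≤ |a|²|b|²`. -/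
theorem dotProduct_sq_le (u v : Fin 2 → ℝ) :
    (dotProduct u v) ^ 2 ≤ dotProduct u u * dotProduct v v := by
  rw [dotProduct_sq_eq_polar]
  have hc : Real.cos (ang u - ang v) ^ 2 ≤ 1 := by
    rw [sq_le_one_iff_abs_le_one]; exact Real.abs_cos_le_one _
  have h0 : 0 ≤ dotProduct u u * dotProduct v v := by
    rw [← norm_toC_sq, ← norm_toC_sq]; positivity
  nlinarith

/-- `0 ≤ ⟪u, u⟫`. -/
theorem dotProduct_self_nonneg' (u : Fin 2 → ℝ) : 0 ≤ dotProduct u u := by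
  rw [← norm_toC_sq]; positivity

/-! ### The net constants -/

/-- Choice of the number of cells `J = ⌈16 π √(Λ/τ) / η⌉` and its two properties:
garbage entries are `≤ τ`, and `J² Λ ≤ 289 π² Λ² / (η² τ)`. -/
theorem net_constants {Λ τ η θ₀ : ℝ} (hη : 0 < η) (hη1 : η ≤ 1) (hτ : 0 < τ) (hΛτ : τ < Λ)
    (hθ : 0 ≤ θ₀) :
    ∃ J : ℕ, 0 < J ∧ Λ * (8 * width J / η) ^ 2 ≤ τ ∧
      ((J : ℝ) ^ 2) * (Λ * θ₀) ≤ (289 * π ^ 2) * Λ ^ 2 / (η ^ 2 * τ) * θ₀ := by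
  have hΛ0 : 0 < Λ := hτ.trans hΛτ
  set s : ℝ := Real.sqrt (Λ / τ) with hs
  have hΛτ1 : 1 ≤ Λ / τ := by rw [le_div_iff₀ hτ]; linarith
  have hs1 : 1 ≤ s := by rw [hs]; exact Real.one_le_sqrt.2 hΛτ1
  have hs0 : 0 < s := by linarith
  have hss : s ^ 2 = Λ / τ := by rw [hs]; exact Real.sq_sqrt (by positivity)
  set Jr : ℝ := 16 * π * s / η with hJr
  have hπ1 : (1 : ℝ) ≤ π := by linarith [Real.two_le_pi]
  have hπs : 1 ≤ π * s / η := by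
    rw [le_div_iff₀ hη]
    nlinarith
  have hJr0 : 0 < Jr := by rw [hJr]; positivity
  set J : ℕ := ⌈Jr⌉₊ with hJdef
  have hJ : 0 < J := Nat.ceil_pos.2 hJr0
  have hJle : Jr ≤ (J : ℝ) := Nat.le_ceil Jr
  have hJup : (J : ℝ) ≤ 17 * π * s / η := by
    have h1 : (J : ℝ) < Jr + 1 := Nat.ceil_lt_add_one hJr0.le
    have h2 : Jr + 1 ≤ 17 * π * s / η := by
      rw [hJr]
      have : 16 * π * s / η + π * s / η = 17 * π * s / η := by ring
      linarith
    linarith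
  have hJreal : (0 : ℝ) < J := by exact_mod_cast hJ
  refine ⟨J, hJ, ?_, ?_⟩
  · -- garbage threshold
    have hw1 : width J * (8 * s) ≤ η := by
      rw [width]
      have h16 : 16 * π * s ≤ η * J := by
        have := (div_le_iff₀ hη).1 hJle
        linarith
      rw [div_mul_eq_mul_div, div_le_iff₀ hJreal]
      nlinarith
    have h8 : 8 * width J / η ≤ 1 / s := by
      rw [div_le_div_iff₀ hη hs0]
      nlinarith
    have h80 : 0 ≤ 8 * width J / η := by
      have := width_pos hJ
      positivity
    have hsq : (8 * width J / η) ^ 2 ≤ (1 / s) ^ 2 := pow_le_pow_left₀ h80 h8 2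
    calc Λ * (8 * width J / η) ^ 2 ≤ Λ * (1 / s) ^ 2 := mul_le_mul_of_nonneg_left hsq hΛ0.le
      _ = Λ * (τ / Λ) := by rw [one_div, inv_pow, hss, inv_div]
      _ = τ := mul_div_cancel₀ _ hΛ0.ne'
  · -- cell-pair count
    have hJ2 : (J : ℝ) ^ 2 ≤ (17 * π * s / η) ^ 2 := pow_le_pow_left₀ hJreal.le hJup 2
    have heq : (17 * π * s / η) ^ 2 * (Λ * θ₀) = (289 * π ^ 2) * Λ ^ 2 / (η ^ 2 * τ) * θ₀ := by
      rw [div_pow, mul_pow, mul_pow, hss]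
      field_simp
      ring
    calc ((J : ℝ) ^ 2) * (Λ * θ₀) ≤ (17 * π * s / η) ^ 2 * (Λ * θ₀) :=
          mul_le_mul_of_nonneg_right hJ2 (by positivity)
      _ = _ := heq


end Summit.PneNP.PneNP.Theorems.SmallBlockRothvoss


end
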